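import Summits.ValiantsHypothesis.ValiantsHypothesis.Theorems.LacunarySymmetroidMatrixDescartesCensusWindowSupportCard
import Summits.ValiantsHypothesis.ValiantsHypothesis.Theorems.LacunarySymmetroidMatrixDescartesCensusSignVariationsFewnomial
import Summits.ValiantsHypothesis.ValiantsHypothesis.Theorems.LacunarySymmetroidMatrixDescartesCensusBoxKit
import Summits.ValiantsHypothesis.ValiantsHypothesis.Theorems.LacunarySymmetroidMatrixDescartesCensusTNCUnifKit
import Summits.ValiantsHypothesis.ValiantsHypothesis.Theorems.LacunarySymmetroidMatrixDescartesCensusTNC35Rows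
import Literature.Topology.PlanarFoliations.Monotone
import Mathlib.Analysis.MeanInequalities

/-!
# `MatrixDescartes` census — kit for the V = 19 layer of door A (kernel replays of the Case A / Case B certificates)

HONEST FRAMING.  Object-search cell `pub-symmetroid`, route `LacunarySymmetroid`; door-A item `Theses.LacunarySymmetroid.DoorA26`
(stmt-ValiantsHypothesis-19979) and its sharper support rows `PosRootLawOn 2 6 18 d`.  Small reusable lemmas for the per-support
kernel replays of engine-3 g15's door-A certificates (`HOME/pub-symmetroid-engine-3/box20/doorA/caseA-oneslack-box18.jsonl`,
`caseB-onezero-box20.jsonl`; README-BOX20-e3g15 §3), companions of `…CensusBoxKit` (V = 20 layer):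

* `exists_consecutive_repetition_of_signVariations_le` — if `Var(f) + 2 ≤ #supp f` then some two CONSECUTIVE support exponents
  carry coefficients of the same sign (the converse direction of the tree's `coeff_mul_coeff_neg_of_signVariations`); this is how a
  hypothetical nineteen with `21` non-zero coefficients and `Var = 19` is put into engine-3's Case A;
* sign chaining along the coefficient sequence: `mul_neg_of_mul_neg_of_mul_pos` (from `x·y < 0`, `0 < y·z` to `x·z < 0`), the fourth
  member of the family whose other three are already in the tree (`Census.mul_pos_of_mul_neg_of_mul_neg`,
  `Census.mul_neg_of_mul_pos_of_mul_neg` in `…CensusTNCUnifKit`, `Literature.Topology.PlanarFoliations.mul_pos_of_mul_pos_of_mul_pos`);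
* `prod_ite_abs_sub_eq_natCast` — the window weight `∏_{u ∈ s} (u = a ? 1 : |a − u|)` of the support-form window lemmas
  (`Census.nineteen_window_two_six_card`) evaluated as a natural number, so that `decide` computes it (the `erase` form is the
  tree's `Census.prod_abs_sub_natCast_35`);
* `polarDet_triangle_pos_of_null` — the «odd cycle through a NULL letter» kill of Case B (a non-zero null letter `S` (`det S = 0`)
  keeps a nappe: for definite `T`, `U` the three polarised determinants have positive product), from `g3_nonneg`;
* `card_support_eq_of_coeff_eq_zero` — Case B bookkeeping: `19` distinct positive roots, support inside a `21`-set `E` and one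
  vanishing coefficient `f_e = 0`, `e ∈ E` ⇒ `supp f = E.erase e` (Descartes: `#Z₊ < #supp`).

Nothing here bears on `ζ_sym`, on `DoorA26`/`DoorA34` (OPEN, never asserted), on `MatrixDescartes` (stmt-ValiantsHypothesis-18050)
or on `VP ≠ VNP`.

[folklore] Elementary.
-/

-- `Summit.ValiantsHypothesis.ValiantsHypothesis.…` repeats a component by the D-0017 layout
-- (single-conjunct summit), which the `dupNamespace` linter flags; the name is mandated.
set_option linter.dupNamespace false

namespace Summit.ValiantsHypothesis.ValiantsHypothesis.Theorems.LacunarySymmetroidMatrixDescartes.Census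

open Polynomial Finset
open scoped BigOperators Polynomial

/-! ### A repetition exists when `Var ≤ #supp − 2` -/

/-- If `Var(f) + 2 ≤ #supp f` then two CONSECUTIVE support exponents `a < b` of `f` carry coefficients of the same sign.
(With the enumeration of the support, `Var(f)` is the number of alternating adjacent pairs, `signVariations_rsum`.) [folklore] -/
theorem exists_consecutive_repetition_of_signVariations_le (f : ℝ[X]) (hf : f ≠ 0)
    (hV : f.signVariations + 2 ≤ f.support.card) :
    ∃ a ∈ f.support, ∃ b ∈ f.support, a < b ∧ (∀ u ∈ f.support, ¬ (a < u ∧ u < b)) ∧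
      0 < f.coeff a * f.coeff b := by
  classical
  obtain ⟨e, he, hmem, hsurj, hsum⟩ := exists_strictMono_enum_support f hf
  set n := f.support.card with hn
  have hn1 : 1 ≤ n := by omega
  have hcoef : ∀ s, s < n → f.coeff (e s) ≠ 0 := fun s hs => mem_support_iff.mp (hmem s hs)
  have hVr := signVariations_rsum n hn1 e he (fun s => f.coeff (e s)) hcoef
  rw [← hsum] at hVr
  -- not every adjacent pair alternates
  obtain ⟨t, ht, hnot⟩ : ∃ t ∈ range (n - 1), ¬ (f.coeff (e t) * f.coeff (e (t + 1)) < 0) := by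
    by_contra hall
    push Not at hall
    have : (∑ t ∈ range (n - 1), (if f.coeff (e t) * f.coeff (e (t + 1)) < 0 then 1 else 0)) = n - 1 := by
      rw [Finset.sum_congr rfl fun t ht => if_pos (hall t ht), Finset.sum_const, Finset.card_range, smul_eq_mul, mul_one]
    omega
  have ht' : t + 1 < n := by have := mem_range.mp ht; omega
  refine ⟨e t, hmem t (by omega), e (t + 1), hmem (t + 1) ht', he (Nat.lt_succ_self t), ?_, ?_⟩
  · intro u hu ⟨h1, h2⟩
    obtain ⟨s, hs, rfl⟩ := hsurj u hu
    have h1' := he.lt_iff_lt.mp h1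
    have h2' := he.lt_iff_lt.mp h2
    omega
  · have h0 : f.coeff (e t) * f.coeff (e (t + 1)) ≠ 0 := mul_ne_zero (hcoef t (by omega)) (hcoef (t + 1) ht')
    rcases lt_trichotomy (f.coeff (e t) * f.coeff (e (t + 1))) 0 with h | h | h
    · exact absurd h hnot
    · exact absurd h h0
    · exact h

/-! ### Sign chaining -/

/-- From `x·y < 0` and `0 < y·z`: `x·z < 0` (companion of `Census.mul_pos_of_mul_neg_of_mul_neg`,
`Census.mul_neg_of_mul_pos_of_mul_neg`). [folklore] -/
theorem mul_neg_of_mul_neg_of_mul_pos {x y z : ℝ} (h1 : x * y < 0) (h2 : 0 < y * z) : x * z < 0 := by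
  have h := mul_pos_of_mul_neg_of_mul_neg (a := x) (b := y) (c := -z) h1 (by linarith [show y * -z = -(y * z) by ring])
  linarith [show x * -z = -(x * z) by ring]

/-! ### Window weights as natural numbers -/

/-- The window weight of the support-form window lemmas, `∏_{u ∈ s} (u = a ? 1 : |a − u|)`, over a finite set of natural exponents
is the cast of a natural number — lets `decide` evaluate it. [folklore] -/
theorem prod_ite_abs_sub_eq_natCast (s : Finset ℕ) (a : ℕ) :
    (∏ u ∈ s, (if u = a then (1 : ℝ) else |(a : ℝ) - (u : ℝ)|))
      = ((∏ u ∈ s, (if u = a then 1 else ((a : ℤ) - (u : ℤ)).natAbs) : ℕ) : ℝ) := by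
  rw [Nat.cast_prod]
  refine Finset.prod_congr rfl fun u _ => ?_
  split_ifs
  · simp
  · rw [Nat.cast_natAbs]; push_cast; rfl

/-! ### Null letters keep a nappe (Case B sign kills) -/

/-- **Odd cycle through a null letter.**  Let `S = [[a,b],[b,c]]` be a NULL letter (`ac − b² = 0`) and `T`, `U` DEFINITE
(`det > 0`), with `β(S,U) ≠ 0`.  Then `β(S,T)·β(T,U)·β(S,U) > 0` (`β` = twice the polar form of `det`): by `G3 ≥ 0` with
`det S = 0`, `β(S,T)β(T,U)β(S,U) ≥ det T · β(S,U)² + det U · β(S,T)² > 0`.  (A non-zero null letter is `±vvᵀ` and pairs with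
a definite letter on its nappe positively — the 2-colouring of engine-3's Case B extends to null letters.) [folklore] -/
theorem polarDet_triangle_pos_of_null (a b c a' b' c' a'' b'' c'' : ℝ) (hS : a * c - b ^ 2 = 0)
    (hT : 0 < a' * c' - b' ^ 2) (hU : 0 < a'' * c'' - b'' ^ 2)
    (hSU : a * c'' + c * a'' - 2 * (b * b'') ≠ 0) :
    0 < (a * c' + c * a' - 2 * (b * b')) * (a' * c'' + c' * a'' - 2 * (b' * b'')) *
      (a * c'' + c * a'' - 2 * (b * b'')) := by
  have hg := g3_nonneg a b c a' b' c' a'' b'' c''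
  rw [hS] at hg
  have h1 : 0 < (a' * c' - b' ^ 2) * (a * c'' + c * a'' - 2 * (b * b'')) ^ 2 :=
    mul_pos hT (by positivity)
  have h2 : 0 ≤ (a'' * c'' - b'' ^ 2) * (a * c' + c * a' - 2 * (b * b')) ^ 2 :=
    mul_nonneg hU.le (sq_nonneg _)
  nlinarith

/-! ### Case B bookkeeping -/

/-- **Case B support.**  If `f` has at least `19` distinct positive roots, `supp f ⊆ E` with `#E = 21`, and `f_e = 0` for some
`e ∈ E`, then `supp f = E.erase e` (Descartes gives `#supp f ≥ 20`). [folklore] -/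
theorem support_eq_erase_of_coeff_eq_zero (f : ℝ[X]) (E : Finset ℕ) (hE : E.card = 21) (hsub : f.support ⊆ E)
    (hZ : 19 ≤ (f.roots.toFinset.filter (fun t => 0 < t)).card) {e : ℕ} (he : e ∈ E) (hfe : f.coeff e = 0) :
    f.support = E.erase e := by
  have hf : f ≠ 0 := by rintro rfl; simp at hZ
  have hlt := Literature.Computability.AlgebraicComplexity.card_roots_toFinset_filter_pos_lt_card_support hf
  have hsub' : f.support ⊆ E.erase e := fun u hu =>
    Finset.mem_erase.mpr ⟨fun h => (mem_support_iff.mp hu) (h ▸ hfe), hsub hu⟩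
  refine Finset.eq_of_subset_of_card_le hsub' ?_
  rw [Finset.card_erase_of_mem he, hE]
  omega

/-- **Case A support.**  If `f` has at least `19` distinct positive roots, `supp f ⊆ E` with `#E = 21` and `Var(f) ≤ 19`, then
EITHER some `e ∈ E` has `f_e = 0` (Case B) OR `supp f = E` and two consecutive support exponents repeat a sign (Case A).
[folklore] -/
theorem caseB_or_caseA (f : ℝ[X]) (E : Finset ℕ) (hE : E.card = 21) (hsub : f.support ⊆ E)
    (hZ : 19 ≤ (f.roots.toFinset.filter (fun t => 0 < t)).card) (hV : f.signVariations ≤ 19) :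
    (∃ e ∈ E, f.coeff e = 0) ∨
    (f.support = E ∧ ∃ a ∈ f.support, ∃ b ∈ f.support, a < b ∧ (∀ u ∈ f.support, ¬ (a < u ∧ u < b)) ∧
      0 < f.coeff a * f.coeff b) := by
  classical
  have hf : f ≠ 0 := by rintro rfl; simp at hZ
  by_cases h : ∃ e ∈ E, f.coeff e = 0
  · exact Or.inl h
  · push Not at h
    have hsupp : f.support = E := by
      refine Finset.Subset.antisymm hsub fun e he => mem_support_iff.mpr (h e he)
    refine Or.inr ⟨hsupp, exists_consecutive_repetition_of_signVariations_le f hf ?_⟩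
    rw [hsupp, hE]; omega

/-! ### AM–GM with four terms (engine-3's `amgm4` sub-rows) -/

/-- AM–GM row with four terms: `a, b, c, d ≥ 0`, `a + b + c + d ≤ t` ⇒ `256·a·b·c·d ≤ t⁴` (the `amgm4` sub-row of a
single-positive-term Gram inequality in engine-3 g15's certificates; companions `four_mul_le_sq_of_add_le`, `amgm_three_le_cube_of_add_le`
in `…CensusBoxKit`). [folklore] -/
theorem amgm_four_le_pow_four_of_add_le {a b c d t : ℝ} (ha : 0 ≤ a) (hb : 0 ≤ b) (hc : 0 ≤ c) (hd : 0 ≤ d)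
    (h : a + b + c + d ≤ t) : 256 * a * b * c * d ≤ t ^ 4 := by
  have h1 : 4 * a * b ≤ (a + b) ^ 2 := by nlinarith [sq_nonneg (a - b)]
  have h2 : 4 * c * d ≤ (c + d) ^ 2 := by nlinarith [sq_nonneg (c - d)]
  have h3 : 4 * (a + b) * (c + d) ≤ (a + b + c + d) ^ 2 := by nlinarith [sq_nonneg (a + b - (c + d))]
  have h4 : (a + b + c + d) ^ 2 ≤ t ^ 2 := by
    have : 0 ≤ a + b + c + d := by positivity
    nlinarith
  have h5 : 256 * a * b * c * d ≤ (4 * (a + b) * (c + d)) ^ 2 := by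
    have e : (4 * (a + b) * (c + d)) ^ 2 = (4 * a * b + 4 * a * b) * 0 + 16 * ((a + b) ^ 2 * (c + d) ^ 2) := by ring
    nlinarith [mul_le_mul h1 h2 (by positivity) (by positivity), mul_nonneg ha hb, mul_nonneg hc hd]
  have h6 : (4 * (a + b) * (c + d)) ^ 2 ≤ ((a + b + c + d) ^ 2) ^ 2 := by
    have : 0 ≤ 4 * (a + b) * (c + d) := by positivity
    exact pow_le_pow_left₀ this h3 2
  have h7 : ((a + b + c + d) ^ 2) ^ 2 ≤ (t ^ 2) ^ 2 := pow_le_pow_left₀ (by positivity) h4 2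
  nlinarith [h5, h6, h7]

/-! ### AM–GM with `n` terms (engine-3's `amgm8` / `amgm9` sub-rows of the 2+2 rows `W(i,j|k,l)`) -/

/-- **AM–GM with `n` terms, product form.**  For non-negative reals `f i` (`i ∈ s`, `#s = n`) with `∑ f ≤ t`:
`n^n · ∏ f ≤ t^n` (engine-3's `amgmN` sub-rows). [folklore] -/
theorem card_pow_mul_prod_le_pow_of_sum_le {ι : Type*} (s : Finset ι) (f : ι → ℝ) (hf : ∀ i ∈ s, 0 ≤ f i)
    {t : ℝ} (h : ∑ i ∈ s, f i ≤ t) :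
    (s.card : ℝ) ^ s.card * ∏ i ∈ s, f i ≤ t ^ s.card := by
  rcases s.eq_empty_or_nonempty with rfl | hne
  · simp
  have hn : 0 < (s.card : ℝ) := by exact_mod_cast Finset.card_pos.mpr hne
  have hsum0 : 0 ≤ ∑ i ∈ s, f i := Finset.sum_nonneg hf
  -- AM–GM (weighted, equal weights 1/n)
  have hw := Real.geom_mean_le_arith_mean_weighted s (fun _ => 1 / (s.card : ℝ)) f
    (fun _ _ => by positivity) (by rw [Finset.sum_const, nsmul_eq_mul]; field_simp) hf
  -- ∏ f^(1/n) = (∏ f)^(1/n)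
  have hprod : ∏ i ∈ s, f i ^ (1 / (s.card : ℝ)) = (∏ i ∈ s, f i) ^ (1 / (s.card : ℝ)) :=
    Real.finsetProd_rpow s f hf _
  rw [hprod, ← Finset.mul_sum] at hw
  -- raise to the n-th power
  have hP0 : 0 ≤ ∏ i ∈ s, f i := Finset.prod_nonneg hf
  have h1 : ((∏ i ∈ s, f i) ^ (1 / (s.card : ℝ))) ^ s.card = ∏ i ∈ s, f i := by
    rw [← Real.rpow_natCast, ← Real.rpow_mul hP0, one_div_mul_cancel hn.ne', Real.rpow_one]
  have h2 : ((∏ i ∈ s, f i) ^ (1 / (s.card : ℝ))) ^ s.card ≤ (1 / (s.card : ℝ) * ∑ i ∈ s, f i) ^ s.card :=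
    pow_le_pow_left₀ (Real.rpow_nonneg hP0 _) hw _
  rw [h1, mul_pow] at h2
  have h3 : (∑ i ∈ s, f i) ^ s.card ≤ t ^ s.card := pow_le_pow_left₀ hsum0 h _
  have h4 : (s.card : ℝ) ^ s.card * ((1 / (s.card : ℝ)) ^ s.card * (∑ i ∈ s, f i) ^ s.card) = (∑ i ∈ s, f i) ^ s.card := by
    rw [← mul_assoc, ← mul_pow, mul_one_div_cancel hn.ne', one_pow, one_mul]
  calc (s.card : ℝ) ^ s.card * ∏ i ∈ s, f i
      ≤ (s.card : ℝ) ^ s.card * ((1 / (s.card : ℝ)) ^ s.card * (∑ i ∈ s, f i) ^ s.card) :=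
        mul_le_mul_of_nonneg_left h2 (by positivity)
    _ = (∑ i ∈ s, f i) ^ s.card := h4
    _ ≤ t ^ s.card := h3

/-- AM–GM row with eight terms (engine-3's `amgm8`): `8⁸ · ∏ aᵢ ≤ t⁸`. [folklore] -/
theorem amgm_eight_le_pow_of_add_le {a1 a2 a3 a4 a5 a6 a7 a8 t : ℝ} (h1 : 0 ≤ a1) (h2 : 0 ≤ a2) (h3 : 0 ≤ a3) (h4 : 0 ≤ a4)
    (h5 : 0 ≤ a5) (h6 : 0 ≤ a6) (h7 : 0 ≤ a7) (h8 : 0 ≤ a8) (h : a1 + a2 + a3 + a4 + a5 + a6 + a7 + a8 ≤ t) :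
    16777216 * a1 * a2 * a3 * a4 * a5 * a6 * a7 * a8 ≤ t ^ 8 := by
  have key := card_pow_mul_prod_le_pow_of_sum_le (Finset.univ : Finset (Fin 8)) ![a1, a2, a3, a4, a5, a6, a7, a8]
    (by intro i _; fin_cases i <;> assumption) (t := t) (by simp [Fin.sum_univ_succ]; linarith)
  simp [Fin.prod_univ_succ] at key
  norm_num at key
  linarith [key]

/-- AM–GM row with nine terms (engine-3's `amgm9`): `9⁹ · ∏ aᵢ ≤ t⁹`. [folklore] -/
theorem amgm_nine_le_pow_of_add_le {a1 a2 a3 a4 a5 a6 a7 a8 a9 t : ℝ} (h1 : 0 ≤ a1) (h2 : 0 ≤ a2) (h3 : 0 ≤ a3)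
    (h4 : 0 ≤ a4) (h5 : 0 ≤ a5) (h6 : 0 ≤ a6) (h7 : 0 ≤ a7) (h8 : 0 ≤ a8) (h9 : 0 ≤ a9)
    (h : a1 + a2 + a3 + a4 + a5 + a6 + a7 + a8 + a9 ≤ t) :
    387420489 * a1 * a2 * a3 * a4 * a5 * a6 * a7 * a8 * a9 ≤ t ^ 9 := by
  have key := card_pow_mul_prod_le_pow_of_sum_le (Finset.univ : Finset (Fin 9)) ![a1, a2, a3, a4, a5, a6, a7, a8, a9]
    (by intro i _; fin_cases i <;> assumption) (t := t) (by simp [Fin.sum_univ_succ]; linarith)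
  simp [Fin.prod_univ_succ] at key
  norm_num at key
  linarith [key]

end Summit.ValiantsHypothesis.ValiantsHypothesis.Theorems.LacunarySymmetroidMatrixDescartes.Census
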